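import Literature.NumberTheory.Sieve.MontgomeryVaughan1975MajorArcs
import HarnessLib

/-!
# Exceptional conductors are unbounded in the level (Page/Landau-type finiteness), PROVED

Topic `Literature/NumberTheory/Sieve`, namespace `Literature.NumberTheory.Sieve.MontgomeryVaughan1975`
(continuation of `MontgomeryVaughan1975MajorArcs.lean`: the `c₁`-exceptional zero data
`IsExceptionalZero c₁ P r χ β` — `χ` primitive, `χ ≠ 1`, `r ≤ P`, `1 − c₁/log P ≤ β < 1`, `L(β, χ) = 0`
[MontgomeryVaughanActa1975, §4 Lemma 4.1]).

For a FIXED modulus `r` and a character `χ ≠ 1 (mod r)`, `L(s, χ)` is continuous with `L(1, χ) ≠ 0`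
(Mathlib: `DirichletCharacter.differentiable_LFunction`, `LFunction_ne_zero_of_one_le_re`), so it has
no real zero in `(1 − ε_χ, 1)` for some `ε_χ > 0`; there are finitely many characters to each of the
finitely many moduli `r ≤ R`.  Hence a `c₁`-exceptional zero at level `P` (`β ≥ 1 − c₁/log P`) has
conductor `r > R` as soon as `P ≥ P₀(c₁, R)` — the qualitative form of «`(1 − β̃) ≫ r̃^{−1/2}(log r̃)^{−1}`,
so `r̃ → ∞` as `β̃ → 1`» used throughout [MontgomeryVaughanActa1975, §8] (Siegel's theorem there; the
ineffective strength is not needed for `r̃ → ∞`).  This is the piece `ExceptionalConductorUnbounded` of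
the parity-ideate route `LinnikGallagherMV` (crux «PointwiseMajorArcsMV»), VERBATIM
(`exceptionalConductor_unbounded`).  No new facts.  Written for the parity-ideate cell (literature
seat g15, 2026-08-27).

## References

* [MontgomeryVaughanActa1975] H. L. Montgomery, R. C. Vaughan, *The exceptional set in Goldbach's
  problem*, Acta Arith. 27 (1975) 353–370: §4 Lemma 4.1 (exceptional zero), §8 (the size of `r̃`).
* [MontgomeryVaughan2007] H. L. Montgomery, R. C. Vaughan, *Multiplicative Number Theory I*, CUP 2007,
  Cor. 11.10 (Page) and §11.2 (for each `q`, `L(σ, χ) ≠ 0` on `[1 − c(q), 1]`).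

## Mathlib / tree search

Tree: `IsExceptionalZero` (`MontgomeryVaughan1975MajorArcs`). Mathlib:
`DirichletCharacter.differentiable_LFunction`, `DirichletCharacter.LFunction_ne_zero_of_one_le_re`,
`Finite (DirichletCharacter ℂ r)`, `Filter.eventually_all`, `Filter.eventually_all_finset`.
`lean search 'exceptionalConductor|ConductorUnbounded'`: nothing before this file.
-/

noncomputable section

open Filter Topology

namespace Literature.NumberTheory.Sieve.MontgomeryVaughan1975

/-- **One character has no exceptional zero at large levels**: for fixed `r`, `χ (mod r)` and `c₁`,
`¬ IsExceptionalZero c₁ P r χ β` for every `β`, for all large `P` (continuity of `L(s, χ)` at `s = 1`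
and `L(1, χ) ≠ 0`). [cite: MontgomeryVaughan2007, §11.2 (L(σ,χ) ≠ 0 near σ = 1 for each χ)] -/
theorem eventually_not_isExceptionalZero (c₁ : ℝ) (r : ℕ) [NeZero r] (χ : DirichletCharacter ℂ r) :
    ∀ᶠ P : ℝ in atTop, ∀ β : ℝ, ¬ IsExceptionalZero c₁ P r χ β := by
  by_cases hχ : χ = 1
  · exact Eventually.of_forall fun P β h => h.2.1 hχ
  · -- `L(s, χ) ≠ 0` on a neighbourhood of `1`
    have hcont : Continuous χ.LFunction := (DirichletCharacter.differentiable_LFunction hχ).continuous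
    have h1 : χ.LFunction 1 ≠ 0 :=
      DirichletCharacter.LFunction_ne_zero_of_one_le_re χ (Or.inl hχ) (by simp)
    have hopen : IsOpen {s : ℂ | χ.LFunction s ≠ 0} := isOpen_ne_fun hcont continuous_const
    obtain ⟨ε, hε, hball⟩ := Metric.isOpen_iff.mp hopen 1 h1
    -- eventually `c₁ / log P < ε`
    have hlog : Tendsto (fun P : ℝ => c₁ / Real.log P) atTop (𝓝 0) :=
      tendsto_const_nhds.div_atTop Real.tendsto_log_atTop
    filter_upwards [hlog.eventually (eventually_lt_nhds hε)] with P hP β hβ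
    obtain ⟨-, -, -, hβlo, hβ1, hzero⟩ := hβ
    have hdist : dist (β : ℂ) 1 < ε := by
      rw [Complex.dist_eq, show (β : ℂ) - 1 = ((β - 1 : ℝ) : ℂ) by push_cast; ring,
        Complex.norm_real, Real.norm_eq_abs, abs_of_nonpos (by linarith)]
      linarith
    exact hball hdist hzero

/-- **Exceptional conductors are unbounded in the level** — VERBATIM the piece
`ExceptionalConductorUnbounded` of the parity-ideate route `LinnikGallagherMV`: for every `c₁ > 0` and
`R` there is `P₀` such that for `P ≥ P₀` every `c₁`-exceptional zero datum `(r, χ, β)` at level `P` has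
`r > R` (finitely many characters to the moduli `r ≤ R`, each without real zeros near `1`).
[cite: MontgomeryVaughanActa1975, §8 (r̃ → ∞ as the level grows, via (1 − β̃) ≫ r̃^{-1/2}(log r̃)^{-1}); MontgomeryVaughan2007, Cor. 11.10] -/
theorem exceptionalConductor_unbounded :
    ∀ c₁ : ℝ, 0 < c₁ → ∀ R : ℕ, ∃ P₀ : ℝ, ∀ P : ℝ, P₀ ≤ P →
      ∀ (r : ℕ) [NeZero r] (χ : DirichletCharacter ℂ r) (β : ℝ),
        IsExceptionalZero c₁ P r χ β → R < r := by
  intro c₁ _ R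
  -- for every `r ≤ R` (with `NeZero r`) and every `χ (mod r)`: eventually no exceptional zero
  have hev : ∀ᶠ P : ℝ in atTop, ∀ r ∈ Finset.range (R + 1), ∀ h : NeZero r,
      ∀ (χ : DirichletCharacter ℂ r) (β : ℝ), ¬ @IsExceptionalZero c₁ P r h χ β := by
    refine (eventually_all_finset _).mpr fun r _ => ?_
    by_cases hr : r = 0
    · subst hr
      exact Eventually.of_forall fun P h => absurd rfl h.out
    · haveI : NeZero r := ⟨hr⟩
      have hall : ∀ᶠ P : ℝ in atTop, ∀ (χ : DirichletCharacter ℂ r) (β : ℝ),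
          ¬ IsExceptionalZero c₁ P r χ β :=
        eventually_all.mpr fun χ => eventually_not_isExceptionalZero c₁ r χ
      filter_upwards [hall] with P hP h χ β
      exact hP χ β
  obtain ⟨P₀, hP₀⟩ := eventually_atTop.mp hev
  refine ⟨P₀, fun P hP r _ χ β hexc => ?_⟩
  by_contra hRr
  push Not at hRr
  exact hP₀ P hP r (Finset.mem_range.mpr (Nat.lt_succ_of_le hRr)) ‹NeZero r› χ β hexc

end Literature.NumberTheory.Sieve.MontgomeryVaughan1975

end
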